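import Mathlib
import HarnessLib
import Summits.ValiantsHypothesis.ValiantsHypothesis.Theorems.KPlusLogSqLawWeakLiftingTowerGraftInflectionLawSizeOne

/-!
# Tower graft line — THE TROPICAL WRONSKIAN LAW (typed): uniquely dominant pairs are NON-NESTING

Companion of `…TowerGraftInflectionLawSizeOne` (hand g9, p825760 / p826018 / p826109; LINE (B) `Cruxes/WeakLifting/Lines/tower_graft.lean`,
crux `WeakLifting` = stmt-ValiantsHypothesis-19561, rung S4b via hand g8's inflection class law, size-one sector = «Wronskian of two
fewnomials»).  NO stub is claimed.

That file records (§2, prose) the tropical reason why the Wronskian `W(u,v) = Σ_{a<b} P_{ab}(d_b − dₐ) X^{dₐ+d_b − 1}` of two `K`-nomials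
should have only `2K − 4` positive zeros although Descartes allows `C(K,2) − 1`: the Plücker relation `P_il P_jk = P_ik P_jl − P_ij P_kl`
forces, after valuation, the INNER FOUR-POINT INEQUALITY `w_il + w_jk ≤ max (w_ik + w_jl, w_ij + w_kl)` (`i<j<k<l`), and under it no two
strictly nested pairs can both be uniquely dominant.  Here that law is a THEOREM, with a hull-free proof:

* `not_nested_of_dominant` — `d` strictly increasing, `w` satisfying the inner four-point inequality; if `(i,l)` is uniquely dominant at `x`
  (its line `w_il + (dᵢ+d_l)x` strictly above every other pair's line) and `(j,k)` at `y`, `i<j<k<l`, then `False`.  Proof: compare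
  `(i,l)@x + (j,k)@y` with the middle matching placed as `(i,k)@x + (j,l)@y` and as `(j,l)@x + (i,k)@y`:
  `w_il + w_jk − w_ik − w_jl > (d_l − d_k)(y − x)` and `> (dⱼ − dᵢ)(x − y)`, one of which is `≥ 0`; the outer matching likewise; so the inner
  sum is the STRICT maximum of the three — excluded.
* `card_dominantPairs_le` — hence a family of pairs each uniquely dominant somewhere has `≤ 2K − 3` members
  (`InflectionLaw.card_le_of_noNestedPair`): a tropical Wronskian has at most `2K − 3` dominant pairs and `2K − 4` breakpoints — the
  dense-support degree of `W(u,v)/X` — on EVERY support, against the slope-counting `C(K,2) − 1`.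

READING (honest).  This is the tropical shadow of CONJECTURE W («`Z₊(W(u,v)) ≤ 2K − 4`», recorded in the companion file with located
evidence), not a bound on real zeros: for real coefficients the valuation inequality holds only up to `log 2` and the gap weights
`log(d_b − dₐ)` shift the lines, so nested dominance survives in bounded windows (a real no-nesting lemma holds when
`(d_l−dᵢ)(d_k−dⱼ) ≤ 0.618·(dⱼ−dᵢ)(d_l−d_k)`, not typed).  Nothing on S4/S4b/S5, TowerB, `WeakLifting`, Conjecture B, 18050 or VP ≠ VNP.
Def-free; Mathlib + the companion file.  Seat: prover leafhand-val-kpluslogsqlaw-1 g9, `--supports stmt-ValiantsHypothesis-19561 --as helper`.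
[this work; the four-point condition for tropical Plücker vectors / tree metrics is Speyer–Sturmfels 2004 («The tropical Grassmannian»,
Adv. Geom. 4) and Buneman 1974, cited for context only]
-/

-- `Summit.ValiantsHypothesis.ValiantsHypothesis.…` repeats a component by the D-0017 layout
-- (single-conjunct summit), which the `dupNamespace` linter flags; the name is mandated.
set_option linter.dupNamespace false
set_option autoImplicit false

namespace Summit.ValiantsHypothesis.ValiantsHypothesis.Theorems.KPlusLogSqLaw.TowerGraft

open Finset
open scoped BigOperators

namespace InflectionLaw


/-- **No two uniquely dominant pairs are strictly nested** (inner four-point inequality + strictly increasing exponents). [this work] -/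
theorem not_nested_of_dominant {K : ℕ} (d : Fin K → ℝ) (hd : StrictMono d) (w : Fin K → Fin K → ℝ)
    (h4 : ∀ i j k l : Fin K, i < j → j < k → k < l → w i l + w j k ≤ max (w i k + w j l) (w i j + w k l))
    {i j k l : Fin K} (hij : i < j) (hjk : j < k) (hkl : k < l) {x y : ℝ}
    (hx : ∀ a b : Fin K, a < b → (a, b) ≠ (i, l) → w a b + (d a + d b) * x < w i l + (d i + d l) * x)
    (hy : ∀ a b : Fin K, a < b → (a, b) ≠ (j, k) → w a b + (d a + d b) * y < w j k + (d j + d k) * y) : False := by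
  have hik : i < k := hij.trans hjk
  have hjl : j < l := hjk.trans hkl
  have hil : i < l := hik.trans hkl
  have hne1 : (i, k) ≠ (i, l) := fun h => (hkl.ne) (Prod.ext_iff.mp h).2
  have hne2 : (j, l) ≠ (i, l) := fun h => (hij.ne') (Prod.ext_iff.mp h).1
  have hne3 : (i, j) ≠ (i, l) := fun h => (hjl.ne) (Prod.ext_iff.mp h).2
  have hne4 : (k, l) ≠ (i, l) := fun h => (hik.ne') (Prod.ext_iff.mp h).1
  have hne5 : (i, k) ≠ (j, k) := fun h => (hij.ne) (Prod.ext_iff.mp h).1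
  have hne6 : (j, l) ≠ (j, k) := fun h => (hkl.ne') (Prod.ext_iff.mp h).2
  have hne7 : (i, j) ≠ (j, k) := fun h => (hij.ne) (Prod.ext_iff.mp h).1
  have hne8 : (k, l) ≠ (j, k) := fun h => (hjk.ne') (Prod.ext_iff.mp h).1
  have a1 := hx i k hik hne1
  have a2 := hx j l hjl hne2
  have a3 := hx i j hij hne3
  have a4 := hx k l hkl hne4
  have b1 := hy i k hik hne5
  have b2 := hy j l hjl hne6
  have b3 := hy i j hij hne7
  have b4 := hy k l hkl hne8
  have hdij := hd hij
  have hdkl := hd hkl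
  have hdjk := hd hjk
  have hdik := hd hik
  have hdjl := hd hjl
  -- the inner sum strictly exceeds the middle and the outer sums
  have hmid : w i k + w j l < w i l + w j k := by
    rcases le_total x y with hxy | hxy <;> nlinarith
  have hout : w i j + w k l < w i l + w j k := by
    rcases le_total x y with hxy | hxy <;> nlinarith
  have := h4 i j k l hij hjk hkl
  rcases le_max_iff.mp this with h | h <;> linarith

/-- **THE TROPICAL WRONSKIAN LAW** (typed): under the inner four-point inequality and strictly increasing exponents, a family of
pairs each of which is uniquely dominant at some parameter has at most `2K − 3` members.  Reading: a tropical Wronskian of two tropical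
`K`-nomials has at most `2K − 3` dominant pairs, hence at most `2K − 4` breakpoints / sign alternations — the dense-support degree of
`W(u,v)/X`, on every support. [this work] -/
theorem card_dominantPairs_le {K : ℕ} (d : Fin K → ℝ) (hd : StrictMono d) (w : Fin K → Fin K → ℝ)
    (h4 : ∀ i j k l : Fin K, i < j → j < k → k < l → w i l + w j k ≤ max (w i k + w j l) (w i j + w k l))
    (S : Finset (Fin K × Fin K))
    (hS : ∀ p ∈ S, p.1 < p.2 ∧ ∃ x : ℝ, ∀ a b : Fin K, a < b → (a, b) ≠ p → w a b + (d a + d b) * x < w p.1 p.2 + (d p.1 + d p.2) * x) :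
    S.card ≤ 2 * K - 3 := by
  classical
  -- transport to `ℕ × ℕ`
  set f : Fin K × Fin K → ℕ × ℕ := fun p => ((p.1 : ℕ), (p.2 : ℕ)) with hf
  have hfinj : Function.Injective f := by
    intro p q h
    simp only [hf, Prod.mk.injEq] at h
    exact Prod.ext (Fin.ext h.1) (Fin.ext h.2)
  rw [← Finset.card_image_of_injective S hfinj]
  refine card_le_of_noNestedPair K (S.image f) ?_ ?_
  · intro p hp
    obtain ⟨q, hq, rfl⟩ := Finset.mem_image.mp hp
    have h := (hS q hq).1
    exact ⟨Fin.lt_def.mp h, q.2.isLt⟩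
  · intro p hp p' hp' hnest
    obtain ⟨q, hq, rfl⟩ := Finset.mem_image.mp hp
    obtain ⟨q', hq', rfl⟩ := Finset.mem_image.mp hp'
    simp only [hf] at hnest
    obtain ⟨hq1, x, hx⟩ := hS q hq
    obtain ⟨hq'1, y, hy⟩ := hS q' hq'
    -- `q = (i,l)`, `q' = (j,k)` with `i < j < k < l`
    have hij : q.1 < q'.1 := Fin.lt_def.mpr hnest.1
    have hkl : q'.2 < q.2 := Fin.lt_def.mpr hnest.2
    exact not_nested_of_dominant d hd w h4 hij hq'1 hkl
      (fun a b hab hne => hx a b hab (by rwa [ne_eq, ← Prod.mk.eta (p := q)] at hne ⊢))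
      (fun a b hab hne => hy a b hab (by rwa [ne_eq, ← Prod.mk.eta (p := q')] at hne ⊢))

/-! ## §2 (rev 2) The MARGIN form: what survives for REAL coefficients

For real Plücker coordinates the valuation inequality holds only with slack: `|P_il P_jk| ≤ |P_ik P_jl| + |P_ij P_kl| ≤ 2·max`, and the
Wronskian coefficients carry gap weights `log(d_b − dₐ)`; in log-coordinates `w_{ab} = log|P_{ab}(d_b − dₐ)|` this reads
`w_il + w_jk ≤ max (w_ik + w_jl) (w_ij + w_kl) + s` with `s = log 2 + log((d_l−dᵢ)(d_k−dⱼ)/((dⱼ−dᵢ)(d_l−d_k)))` (using the Vandermonde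
three-term identity `(d_k−dᵢ)(d_l−dⱼ) = (dⱼ−dᵢ)(d_l−d_k) + (d_l−dᵢ)(d_k−dⱼ)`).  The typed statement below is the abstract margin law:
with slack `s` in the four-point inequality, two strictly nested pairs cannot both dominate their quadruple competitors WITH MARGIN `m` as soon
as `s < 2m`.  Reading: nested dominance of real Wronskian terms is confined to margins `M = eᵐ` with `M² ≤ 2(d_l−dᵢ)(d_k−dⱼ)/((dⱼ−dᵢ)(d_l−d_k))`
— an exponent-only bound, invisible after coefficient scaling (the tropical law `s = 0`, `m → 0⁺` is `not_nested_of_dominant`).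
-/

/-- **Margin form of the no-nesting law.**  Four-point inequality with slack `s`, dominance over the four quadruple competitors with margin
`m`, `s < 2m` ⇒ two strictly nested pairs cannot both dominate. [this work] -/
theorem not_nested_of_dominant_margin {K : ℕ} (d : Fin K → ℝ) (hd : StrictMono d) (w : Fin K → Fin K → ℝ) (s m : ℝ)
    (hsm : s < 2 * m) {i j k l : Fin K} (hij : i < j) (hjk : j < k) (hkl : k < l)
    (h4 : w i l + w j k ≤ max (w i k + w j l) (w i j + w k l) + s) {x y : ℝ}
    (a1 : w i k + (d i + d k) * x + m ≤ w i l + (d i + d l) * x)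
    (a2 : w j l + (d j + d l) * x + m ≤ w i l + (d i + d l) * x)
    (a3 : w i j + (d i + d j) * x + m ≤ w i l + (d i + d l) * x)
    (a4 : w k l + (d k + d l) * x + m ≤ w i l + (d i + d l) * x)
    (b1 : w i k + (d i + d k) * y + m ≤ w j k + (d j + d k) * y)
    (b2 : w j l + (d j + d l) * y + m ≤ w j k + (d j + d k) * y)
    (b3 : w i j + (d i + d j) * y + m ≤ w j k + (d j + d k) * y)
    (b4 : w k l + (d k + d l) * y + m ≤ w j k + (d j + d k) * y) : False := by
  have hdij := hd hij
  have hdkl := hd hkl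
  have hdjk := hd hjk
  have hdik := hd (hij.trans hjk)
  have hdjl := hd (hjk.trans hkl)
  have hmid : w i k + w j l + 2 * m ≤ w i l + w j k := by
    rcases le_total x y with hxy | hxy <;> nlinarith
  have hout : w i j + w k l + 2 * m ≤ w i l + w j k := by
    rcases le_total x y with hxy | hxy <;> nlinarith
  rcases le_total (w i k + w j l) (w i j + w k l) with h | h
  · rw [max_eq_right h] at h4; linarith
  · rw [max_eq_left h] at h4; linarith

/-- **The slack of a real Plücker vector with Wronskian gap weights.**  If reals satisfy the three-term relation
`pil * pjk = pik * pjl − pij * pkl` (Plücker coordinates of a real 2-plane on a quadruple), then for positive gap weights obeying the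
Vandermonde identity `Vik·Vjl = Vij·Vkl + Vil·Vjk` the weighted products satisfy
`|pil·pjk|·(Vil·Vjk) ≤ (B/(A+B))·|pik·pjl|·(Vik·Vjl) + (B/A)·|pij·pkl|·(Vij·Vkl)` with `A = Vij·Vkl`, `B = Vil·Vjk` — the multiplicative
form of the slack (both ratios `< 1` only when `B < A`; the golden-ratio threshold `B ≤ 0.618·A` makes the two ratios sum to `≤ 1`).
[this work] -/
theorem weighted_pluecker_triangle (pij pik pil pjk pjl pkl A B : ℝ) (hA : 0 < A) (hB : 0 < B)
    (hrel : pil * pjk = pik * pjl - pij * pkl) :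
    |pil * pjk| * B ≤ (B / (A + B)) * (|pik * pjl| * (A + B)) + (B / A) * (|pij * pkl| * A) := by
  have h1 : (B / (A + B)) * (|pik * pjl| * (A + B)) = |pik * pjl| * B := by
    field_simp
  have h2 : (B / A) * (|pij * pkl| * A) = |pij * pkl| * B := by
    field_simp
  rw [h1, h2, ← add_mul]
  refine mul_le_mul_of_nonneg_right ?_ hB.le
  rw [hrel]
  exact abs_sub _ _

/-! ## §3 (rev 3) Self-contained form: TROPICAL PENCILS OF TWO TROPICAL FEWNOMIALS

No Plücker hypothesis left.  A tropical pencil is a pair of weight vectors `α β : Fin K → ℝ` (valuations of the coefficients of `u`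
and `v`); its tropical Plücker vector is the tropical `2 × 2` permanent `w a b = max (α a + β b) (α b + β a)` — and THIS `w` satisfies the
inner four-point inequality identically (`fourPoint_of_tropicalPencil`, four cases).  Hence (`card_dominantPairs_tropicalPencil_le`): for
every strictly increasing `d` and every tropical pencil, at most `2K − 3` pairs are ever uniquely dominant for the lines
`w_{ab} + (dₐ + d_b)x` — the dominant-pair count of the tropical Wronskian `max_{a<b} (w_{ab} + (dₐ+d_b)x)` is linear in `K` on every
support, although `C(K,2)` lines compete. [this work]
-/

/-- the tropical `2 × 2` permanents of a tropical `2 × K` matrix satisfy the inner four-point inequality. [this work] -/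
theorem fourPoint_of_tropicalPencil {K : ℕ} (α β : Fin K → ℝ) (i j k l : Fin K) :
    max (α i + β l) (α l + β i) + max (α j + β k) (α k + β j) ≤
      max (max (α i + β k) (α k + β i) + max (α j + β l) (α l + β j))
          (max (α i + β j) (α j + β i) + max (α k + β l) (α l + β k)) := by
  rcases le_total (α i + β l) (α l + β i) with h1 | h1 <;>
  rcases le_total (α j + β k) (α k + β j) with h2 | h2 <;>
  simp only [max_eq_right h1, max_eq_left h1, max_eq_right h2, max_eq_left h2] <;>
  [ -- (α l + β i) + (α k + β j) = (α k + β i) + (α l + β j) ≤ middle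
    exact le_max_of_le_left (by linarith [le_max_right (α i + β k) (α k + β i), le_max_right (α j + β l) (α l + β j)]);
    -- (α l + β i) + (α j + β k) = (α j + β i) + (α l + β k) ≤ outer
    exact le_max_of_le_right (by linarith [le_max_right (α i + β j) (α j + β i), le_max_right (α k + β l) (α l + β k)]);
    -- (α i + β l) + (α k + β j) = (α i + β j) + (α k + β l) ≤ outer
    exact le_max_of_le_right (by linarith [le_max_left (α i + β j) (α j + β i), le_max_left (α k + β l) (α l + β k)]);
    -- (α i + β l) + (α j + β k) = (α i + β k) + (α j + β l) ≤ middle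
    exact le_max_of_le_left (by linarith [le_max_left (α i + β k) (α k + β i), le_max_left (α j + β l) (α l + β j)]) ]

/-- **Tropical Wronskian law for tropical pencils** (self-contained): with `w a b = max (α a + β b) (α b + β a)`, at most `2K − 3` pairs
are uniquely dominant somewhere along `x ↦ w_{ab} + (dₐ + d_b)x`. [this work] -/
theorem card_dominantPairs_tropicalPencil_le {K : ℕ} (d : Fin K → ℝ) (hd : StrictMono d) (α β : Fin K → ℝ)
    (S : Finset (Fin K × Fin K))
    (hS : ∀ p ∈ S, p.1 < p.2 ∧ ∃ x : ℝ, ∀ a b : Fin K, a < b → (a, b) ≠ p →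
      max (α a + β b) (α b + β a) + (d a + d b) * x < max (α p.1 + β p.2) (α p.2 + β p.1) + (d p.1 + d p.2) * x) :
    S.card ≤ 2 * K - 3 :=
  card_dominantPairs_le d hd (fun a b => max (α a + β b) (α b + β a))
    (fun i j k l _ _ _ => fourPoint_of_tropicalPencil α β i j k l) S hS

/-! ## §4 (rev 4) Adding a letter to a pencil of fewnomials IS a two-digit graft of its Wronskian

The real side of Conjecture W («`Z₊(W(u,v)) ≤ 2K − 4`») by induction on the letters: if the plane `P = span(u,v)` of `K`-nomials has
top exponent `D`, its member `w` without top term and any other member `w′ + γX^D` (`w′` truncated) span it, and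
`W(w, w′ + γX^D) = W(w, w′) + γ·X^{D−1}·(D·w − θw)` (`wronskian_add_top_monomial`): the Wronskian of `P` is the Wronskian of the
TRUNCATED plane `π_top P = span(w, w′)` plus a TWO-DIGIT GRAFT `X^{D−1}·E` whose digit `E = (D − θ)w` is a member of the old pencil
re-weighted by the positive factors `D − dₐ` — exactly the shape `A + X^{D}·E` of the line's corner graft (S4b), with digits separated iff
`D > 2·max d` (the 2-tower condition), so hand g8's `card_posRoots_twoDigit_le` applies to it by name.  LOCATED (honest, scratch
`trunc_test.py`): for generic planes on `(0,1,3,20)`, `(0,1,3,7)`, `(0,1,2,3)`, `(0,1,3,20,135)` truncating the top letter never cost more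
than 2 positive zeros (which would give `2K − 4` by induction), but the «top-truncation costs ≤ 2» lemma is FALSE in general: STAR planes
`P ∋ 1` have `W(1, q) = q′`, and `q′ = N·(∏_{i<N}(X − tᵢ) − X^{N−1})` with clustered `tᵢ ∈ [1, 5/4]` has `≤ 1` positive zero while
`W(1, q + X^N) = N·∏(X − tᵢ)` has `N − 1` (support `{0,…,N}`, `K = N + 1`, cost `N − 2 = K − 3`; still `≤ 2K − 4`).  So an induction must
carry a joint budget (heuristically, in the tower limit `Z₊(W_new) ≈ Z₊^{(0,s)}(W(π_top P)) + Z₊^{(s,∞)}(w) + O(1)` with a sliding scale `s(γ)`).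
-/

open Polynomial
open scoped Polynomial

/-- `X·(X^D)′`-free form of the Wronskian with a monomial: `W(w, X^D) = X^{D−1}·(D·w − θw)` for `D ≥ 1`, `θ = X·d/dX`. [folklore] -/
theorem wronskian_X_pow (w : ℝ[X]) {D : ℕ} (hD : 1 ≤ D) :
    wronskian w ((X : ℝ[X]) ^ D) = X ^ (D - 1) * (C (D : ℝ) * w - X * derivative w) := by
  obtain ⟨n, rfl⟩ : ∃ n, D = n + 1 := ⟨D - 1, by omega⟩
  simp only [wronskian, derivative_X_pow, Nat.add_sub_cancel]
  push_cast
  ring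

/-- **Adding a top letter = two-digit graft of the Wronskian**: `W(w, w′ + γ·X^D) = W(w, w′) + γ·X^{D−1}·(D·w − θw)` (`D ≥ 1`).
The digit `D·w − θw = Σₐ wₐ (D − dₐ) X^{dₐ}` is the old member `w` re-weighted by the positive gaps `D − dₐ`. [this work] -/
theorem wronskian_add_top_monomial (w w' : ℝ[X]) (γ : ℝ) {D : ℕ} (hD : 1 ≤ D) :
    wronskian w (w' + C γ * (X : ℝ[X]) ^ D) =
      wronskian w w' + C γ * X ^ (D - 1) * (C (D : ℝ) * w - X * derivative w) := by
  have h := wronskian_X_pow w hD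
  simp only [wronskian, derivative_add, derivative_mul, derivative_C, zero_mul, zero_add] at h ⊢
  rw [mul_assoc (C γ) (X ^ (D - 1)), ← h]
  ring

/-- the digit in fewnomial form: for `w = Σₐ sₐ X^{dₐ}`, `D·w − θw = Σₐ sₐ (D − dₐ) X^{dₐ}` — same support, same signs when
`D > max dₐ`. [this work] -/
theorem top_digit_fewnomial {K : ℕ} (s : Fin K → ℝ) (d : Fin K → ℕ) (D : ℕ) :
    C (D : ℝ) * (∑ l, C (s l) * (X : ℝ[X]) ^ d l) - X * derivative (∑ l, C (s l) * X ^ d l) =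
      ∑ l, C (s l * ((D : ℝ) - d l)) * X ^ d l := by
  rw [X_mul_derivative_fewnomial, Finset.mul_sum, ← Finset.sum_sub_distrib]
  refine Finset.sum_congr rfl fun l _ => ?_
  simp only [map_mul, map_sub]
  ring

end InflectionLaw

end Summit.ValiantsHypothesis.ValiantsHypothesis.Theorems.KPlusLogSqLaw.TowerGraft
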